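import Summits.HodgeConjecture.HodgeCM.Automorphic.SchwartzStoneVonNeumann_1

/-! PORT of `HodgeCM/Automorphic/SchwartzStoneVonNeumann.lean` (HodgeCMPerL run 82) — part 2: continuation of `Summits.HodgeConjecture.HodgeCM.Automorphic.SchwartzStoneVonNeumann_1` (split at a top-level declaration boundary by port_pkg.py; scope re-opened below; declarations unchanged). -/

-- port_pkg: scope re-opened for this part (file-level context, then the namespace/section stack open at the cut)
noncomputable section
set_option maxSynthPendingDepth 2
open MeasureTheory Filter Set Metric Function intervalIntegral
open scoped RealInnerProductSpace FourierTransform SchwartzMap Topology ContDiff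
namespace HodgeCM
namespace SchwartzWeil
namespace SvN
section Cutoff
variable {E F : Type*} [NormedAddCommGroup E] [NormedSpace ℝ E]
  [NormedAddCommGroup F] [NormedSpace ℝ F]
variable [FiniteDimensional ℝ E]
/-- **Compactly supported Schwartz functions are sequentially dense in `𝓢(E, F)`** (`E` finite dimensional), by bump
cutoffs `u m = χ(·/(m+1)) f` which moreover vanish wherever `f` does.  Hörmander I, Lemma 7.1.8. -/
theorem exists_hasCompactSupport_tendsto (f : 𝓢(E, F)) :
    ∃ u : ℕ → 𝓢(E, F), (∀ m, HasCompactSupport (u m : E → F)) ∧ (∀ m x, f x = 0 → u m x = 0) ∧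
      Tendsto u atTop (𝓝 f) := by
  let χ : ContDiffBump (0 : E) := ⟨1, 2, one_pos, one_lt_two⟩
  have hR : ∀ m : ℕ, (0 : ℝ) < m + 1 := fun m => by positivity
  let L : ℕ → E →L[ℝ] E := fun m => ((m : ℝ) + 1)⁻¹ • ContinuousLinearMap.id ℝ E
  let χR : ℕ → E → ℝ := fun m => (χ : E → ℝ) ∘ L m
  have hχ_smooth : ContDiff ℝ ∞ (χ : E → ℝ) := χ.contDiff
  have hχR_smooth : ∀ m, ContDiff ℝ ∞ (χR m) := fun m => hχ_smooth.comp (L m).contDiff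
  have hχR_zero : ∀ (m : ℕ) (x : E), 2 * ((m : ℝ) + 1) < ‖x‖ → χR m x = 0 := by
    intro m x hx
    have hx' : ((m : ℝ) + 1)⁻¹ • x ∉ Function.support (χ : E → ℝ) := by
      rw [χ.support_eq, mem_ball_zero_iff, norm_smul, norm_inv, Real.norm_of_nonneg (hR m).le,
        not_lt, le_inv_mul_iff₀ (hR m)]
      change ((m : ℝ) + 1) * 2 ≤ ‖x‖
      linarith
    rw [Function.mem_support, not_not] at hx'
    exact hx'
  have hχR_one : ∀ (m : ℕ) (x : E), ‖x‖ ≤ (m : ℝ) + 1 → χR m x = 1 := by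
    intro m x hx
    apply χ.one_of_mem_closedBall
    change ((m : ℝ) + 1)⁻¹ • x ∈ closedBall (0 : E) 1
    rw [mem_closedBall_zero_iff, norm_smul, norm_inv, Real.norm_of_nonneg (hR m).le,
      inv_mul_le_iff₀ (hR m), mul_one]
    exact hx
  have hχR_supp : ∀ m, HasCompactSupport (χR m) := fun m =>
    HasCompactSupport.intro (isCompact_closedBall (0 : E) (2 * ((m : ℝ) + 1))) fun x hx =>
      hχR_zero m x (by simpa [mem_closedBall_zero_iff] using hx)
  have hχR_temp : ∀ m, (χR m).HasTemperateGrowth := fun m =>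
    (hχR_supp m).hasTemperateGrowth (hχR_smooth m)
  refine ⟨fun m => SchwartzMap.smulLeftCLM F (χR m) f, fun m => ?_, fun m x hx => ?_, ?_⟩
  · refine IsCompact.of_isClosed_subset (isCompact_closedBall (0 : E) (2 * ((m : ℝ) + 1)))
      (isClosed_tsupport _) ?_
    refine (SchwartzMap.tsupport_smulLeftCLM_subset _ _).trans (Set.inter_subset_right.trans ?_)
    refine closure_minimal (fun x hx => ?_) isClosed_closedBall
    by_contra h
    exact hx (hχR_zero m x (by simpa [mem_closedBall_zero_iff] using h))
  · rw [SchwartzMap.smulLeftCLM_apply_apply (hχR_temp m), hx, smul_zero]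
  -- uniform bounds on the derivatives of the bump and its rescalings
  have hM : ∀ i : ℕ, ∃ M : ℝ, ∀ y, ‖iteratedFDeriv ℝ i (χ : E → ℝ) y‖ ≤ M := fun i => by
    obtain ⟨x₀, hx₀⟩ := ((hχ_smooth.continuous_iteratedFDeriv (m := i)
      (by exact_mod_cast le_top)).norm).exists_forall_ge_of_hasCompactSupport
      ((χ.hasCompactSupport.iteratedFDeriv i).norm)
    exact ⟨_, hx₀⟩
  choose M hM using hM
  have hM0 : ∀ i, 0 ≤ M i := fun i => (norm_nonneg _).trans (hM i 0)
  have hL1 : ∀ m, ‖L m‖ ≤ 1 := by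
    intro m
    change ‖((m : ℝ) + 1)⁻¹ • ContinuousLinearMap.id ℝ E‖ ≤ 1
    refine (ContinuousLinearMap.opNorm_smul_le _ _).trans ?_
    rw [norm_inv, Real.norm_of_nonneg (hR m).le]
    calc ((m : ℝ) + 1)⁻¹ * ‖ContinuousLinearMap.id ℝ E‖ ≤ 1 * 1 :=
          mul_le_mul (inv_le_one_of_one_le₀ (by linarith [(m.cast_nonneg : (0 : ℝ) ≤ m)]))
            ContinuousLinearMap.norm_id_le (norm_nonneg _) zero_le_one
      _ = 1 := one_mul 1
  have hDχR : ∀ m i x, ‖iteratedFDeriv ℝ i (χR m) x‖ ≤ M i := fun m i x =>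
    (norm_iteratedFDeriv_comp_clm_le hχ_smooth (L m) (hL1 m) i x).trans (hM i _)
  have hDψ : ∀ m i x, ‖iteratedFDeriv ℝ i (fun y => χR m y - 1) x‖ ≤ M i + 1 := by
    intro m i x
    have hsub : (fun y => χR m y - 1) = χR m - fun _ => (1 : ℝ) := rfl
    rw [hsub, iteratedFDeriv_sub_apply ((hχR_smooth m).of_le (by exact_mod_cast le_top)).contDiffAt
      contDiffAt_const]
    refine (norm_sub_le _ _).trans (add_le_add (hDχR m i x) ?_)
    rcases Nat.eq_zero_or_pos i with rfl | hi
    · rw [norm_iteratedFDeriv_zero]; simp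
    · rw [iteratedFDeriv_const_of_ne (Nat.pos_iff_ne_zero.1 hi)]; simp
  -- pointwise identification of `u m - f`
  have hcoe : ∀ m, (⇑(SchwartzMap.smulLeftCLM F (χR m) f - f) : E → F) =
      fun x => (χR m x - 1) • f x := by
    intro m
    funext x
    simp only [sub_apply, SchwartzMap.smulLeftCLM_apply_apply (hχR_temp m), sub_smul,
      one_smul]
  -- the seminorm estimate `p_{k,n}(u m - f) ≤ K / (m + 1)`
  have hest : ∀ k n : ℕ, ∃ K : ℝ, 0 ≤ K ∧ ∀ m : ℕ,
      SchwartzMap.seminorm ℝ k n (SchwartzMap.smulLeftCLM F (χR m) f - f) ≤ K / ((m : ℝ) + 1) := by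
    intro k n
    set S' := (Finset.Iic (k + 1, n)).sup (schwartzSeminormFamily ℝ E F) f with hS'
    have hS'0 : 0 ≤ S' := apply_nonneg _ _
    set K := (∑ i ∈ Finset.range (n + 1), (n.choose i : ℝ) * (M i + 1)) * S' with hK
    have hK0 : 0 ≤ K := by
      refine mul_nonneg (Finset.sum_nonneg fun i _ => ?_) hS'0
      have := hM0 i
      positivity
    refine ⟨K, hK0, fun m => ?_⟩
    refine SchwartzMap.seminorm_le_bound ℝ k n _ (by positivity) fun x => ?_
    rw [hcoe m]
    by_cases hx : ‖x‖ < (m : ℝ) + 1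
    · have hsupp : Function.support (fun y => (χR m y - 1) • f y) ⊆ (ball (0 : E) ((m : ℝ) + 1))ᶜ := by
        intro y hy
        rw [mem_compl_iff, mem_ball_zero_iff, not_lt]
        by_contra h
        push Not at h
        exact hy (by change (χR m y - 1) • f y = 0; rw [hχR_one m y h.le, sub_self, zero_smul])
      have hx' : x ∉ tsupport (fun y => (χR m y - 1) • f y) := fun h =>
        (closure_minimal hsupp isOpen_ball.isClosed_compl h) (mem_ball_zero_iff.2 hx)
      have h0 : iteratedFDeriv ℝ n (fun y => (χR m y - 1) • f y) x = 0 :=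
        Function.notMem_support.1 fun h => hx' (support_iteratedFDeriv_subset n h)
      rw [h0, norm_zero, mul_zero]
      positivity
    · push Not at hx
      have hxpos : 0 < ‖x‖ := (hR m).trans_le hx
      have hψ : ContDiff ℝ n (fun y => χR m y - 1) :=
        ((hχR_smooth m).sub contDiff_const).of_le (by exact_mod_cast le_top)
      have hleib := norm_iteratedFDeriv_smul_le (𝕜 := ℝ) hψ (f.smooth n) x (n := n) le_rfl
      have hterm : ∀ i ∈ Finset.range (n + 1),
          ‖x‖ ^ k * ((n.choose i : ℝ) * ‖iteratedFDeriv ℝ i (fun y => χR m y - 1) x‖ *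
            ‖iteratedFDeriv ℝ (n - i) f x‖) ≤ (n.choose i : ℝ) * (M i + 1) * (S' / ((m : ℝ) + 1)) := by
        intro i _
        have h1 : ‖x‖ ^ k * ‖iteratedFDeriv ℝ (n - i) f x‖ ≤ S' / ((m : ℝ) + 1) := by
          rw [le_div_iff₀ (hR m)]
          have h2 : ‖x‖ ^ (k + 1) * ‖iteratedFDeriv ℝ (n - i) f x‖ ≤ S' :=
            (SchwartzMap.le_seminorm ℝ (k + 1) (n - i) f x).trans
              (Seminorm.le_def.1 (Finset.le_sup (f := schwartzSeminormFamily ℝ E F)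
                (Finset.mem_Iic.2 (Prod.mk_le_mk.2 ⟨le_rfl, Nat.sub_le n i⟩))) f)
          calc ‖x‖ ^ k * ‖iteratedFDeriv ℝ (n - i) f x‖ * ((m : ℝ) + 1)
              ≤ ‖x‖ ^ k * ‖iteratedFDeriv ℝ (n - i) f x‖ * ‖x‖ := by gcongr
            _ = ‖x‖ ^ (k + 1) * ‖iteratedFDeriv ℝ (n - i) f x‖ := by ring
            _ ≤ S' := h2
        calc ‖x‖ ^ k * ((n.choose i : ℝ) * ‖iteratedFDeriv ℝ i (fun y => χR m y - 1) x‖ *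
              ‖iteratedFDeriv ℝ (n - i) f x‖)
            = (n.choose i : ℝ) * ‖iteratedFDeriv ℝ i (fun y => χR m y - 1) x‖ *
                (‖x‖ ^ k * ‖iteratedFDeriv ℝ (n - i) f x‖) := by ring
          _ ≤ (n.choose i : ℝ) * (M i + 1) * (S' / ((m : ℝ) + 1)) :=
              mul_le_mul (mul_le_mul_of_nonneg_left (hDψ m i x) (by positivity)) h1
                (by positivity) (by have := hM0 i; positivity)
      calc ‖x‖ ^ k * ‖iteratedFDeriv ℝ n (fun y => (χR m y - 1) • f y) x‖
          ≤ ‖x‖ ^ k * ∑ i ∈ Finset.range (n + 1), (n.choose i : ℝ) *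
              ‖iteratedFDeriv ℝ i (fun y => χR m y - 1) x‖ * ‖iteratedFDeriv ℝ (n - i) f x‖ := by
            gcongr
        _ = ∑ i ∈ Finset.range (n + 1), ‖x‖ ^ k * ((n.choose i : ℝ) *
              ‖iteratedFDeriv ℝ i (fun y => χR m y - 1) x‖ * ‖iteratedFDeriv ℝ (n - i) f x‖) := by
            rw [Finset.mul_sum]
        _ ≤ ∑ i ∈ Finset.range (n + 1), (n.choose i : ℝ) * (M i + 1) * (S' / ((m : ℝ) + 1)) :=
            Finset.sum_le_sum hterm
        _ = K / ((m : ℝ) + 1) := by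
            rw [hK, ← Finset.sum_mul]
            ring
  -- conclusion
  rw [(schwartz_withSeminorms ℝ E F).tendsto_nhds_atTop]
  rintro ⟨k, n⟩ ε hε
  obtain ⟨K, hK0, hK⟩ := hest k n
  refine ⟨⌈K / ε⌉₊, fun m hm => ?_⟩
  rw [SchwartzMap.schwartzSeminormFamily_apply]
  have hm' : K / ε < (m : ℝ) + 1 :=
    (Nat.le_ceil _).trans_lt (by exact_mod_cast Nat.lt_succ_of_le hm)
  calc SchwartzMap.seminorm ℝ k n (SchwartzMap.smulLeftCLM F (χR m) f - f) ≤ K / ((m : ℝ) + 1) :=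
        hK m
    _ < ε := by
        rw [div_lt_iff₀ (hR m)]
        rw [div_lt_iff₀ hε] at hm'
        linarith

end Cutoff

/-! ### A.4 Exact division by characters -/

section Division

/-- `ec z = e^{2πiz}`, the entire extension of the additive character `𝐞`. -/
def ec (z : ℂ) : ℂ := Complex.exp (2 * Real.pi * Complex.I * z)

/-- (Ported verbatim from the HodgeCMPerL package; no docstring in the source.) -/
theorem fourierChar_eq_ec (r : ℝ) : (𝐞 r : ℂ) = ec r := by
  rw [Real.fourierChar_apply, ec]
  push_cast
  ring_nf

/-- (Ported verbatim from the HodgeCMPerL package; no docstring in the source.) -/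
@[simp] theorem ec_zero : ec 0 = 1 := by simp [ec]

/-- (Ported verbatim from the HodgeCMPerL package; no docstring in the source.) -/
theorem analyticAt_ec (z : ℂ) : AnalyticAt ℂ ec z :=
  (analyticAt_const.mul analyticAt_id).cexp'

/-- (Ported verbatim from the HodgeCMPerL package; no docstring in the source.) -/
theorem hasDerivAt_ec (z : ℂ) : HasDerivAt ec (ec z * (2 * Real.pi * Complex.I)) z := by
  have h := ((hasDerivAt_id z).const_mul (2 * Real.pi * Complex.I)).cexp
  simp only [mul_one] at h
  exact h

/-- `eqt z = (e^{2πiz} - 1)/z`, extended by its limit `2πi` at `z = 0` (Mathlib's `dslope`). -/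
def eqt : ℂ → ℂ := dslope ec 0

/-- (Ported verbatim from the HodgeCMPerL package; no docstring in the source.) -/
theorem mul_eqt (z : ℂ) : z * eqt z = ec z - 1 := by
  have h := sub_smul_dslope ec 0 z
  rw [sub_zero, smul_eq_mul, ec_zero] at h
  exact h

/-- (Ported verbatim from the HodgeCMPerL package; no docstring in the source.) -/
theorem eqt_zero : eqt 0 = 2 * Real.pi * Complex.I := by
  rw [eqt, dslope_same, (hasDerivAt_ec 0).deriv, ec_zero, one_mul]

/-- (Ported verbatim from the HodgeCMPerL package; no docstring in the source.) -/
theorem contDiffAt_eqt (n : WithTop ℕ∞) (z : ℂ) : ContDiffAt ℂ n eqt z := by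
  by_cases hz : z = 0
  · subst hz
    obtain ⟨p, hp⟩ := analyticAt_ec 0
    exact hp.has_fpower_series_dslope_fslope.analyticAt.contDiffAt
  · have heq : eqt =ᶠ[𝓝 z] fun w => (w - 0)⁻¹ • (ec w - ec 0) := by
      filter_upwards [dslope_eventuallyEq_slope_of_ne ec hz] with w hw
      rw [eqt, hw, slope_def_module]
    refine ContDiffAt.congr_of_eventuallyEq ?_ heq
    exact ((contDiffAt_id.sub contDiffAt_const).inv (sub_ne_zero.2 hz)).smul
      ((analyticAt_ec z).contDiffAt.sub contDiffAt_const)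

/-- (Ported verbatim from the HodgeCMPerL package; no docstring in the source.) -/
theorem contDiff_eqt (n : WithTop ℕ∞) : ContDiff ℂ n eqt :=
  contDiff_iff_contDiffAt.2 fun z => contDiffAt_eqt n z

/-- The real restriction `eqR r = (𝐞 r - 1)/r` (`= 2πi` at `0`). -/
def eqR (r : ℝ) : ℂ := eqt r

/-- (Ported verbatim from the HodgeCMPerL package; no docstring in the source.) -/
theorem contDiff_eqR : ContDiff ℝ ∞ eqR :=
  ((contDiff_eqt ∞).restrict_scalars ℝ).comp Complex.ofRealCLM.contDiff

/-- (Ported verbatim from the HodgeCMPerL package; no docstring in the source.) -/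
theorem ofReal_mul_eqR (r : ℝ) : (r : ℂ) * eqR r = (𝐞 r : ℂ) - 1 := by
  rw [fourierChar_eq_ec]
  exact mul_eqt r

/-- (Ported verbatim from the HodgeCMPerL package; no docstring in the source.) -/
theorem eqR_zero : eqR 0 = 2 * Real.pi * Complex.I := by
  rw [eqR, Complex.ofReal_zero, eqt_zero]

/-- **Exact division by `𝐞 r - 1` near `0`**: a smooth `w : ℝ → ℂ` and `δ > 0` with `(𝐞 r - 1) w r = r` for
`|r| ≤ δ` (`w = χ / eqR` with a bump `χ`; `eqR 0 = 2πi ≠ 0`). -/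
theorem exists_smooth_fourierChar_sub_one_mul_eq :
    ∃ (δ : ℝ) (w : ℝ → ℂ), 0 < δ ∧ ContDiff ℝ ∞ w ∧ ∀ r : ℝ, |r| ≤ δ → ((𝐞 r : ℂ) - 1) * w r = r := by
  have hne : eqR 0 ≠ 0 := by
    rw [eqR_zero]
    simp [Real.pi_ne_zero, Complex.I_ne_zero]
  have hev : ∀ᶠ r in 𝓝 (0 : ℝ), eqR r ≠ 0 :=
    (contDiff_eqR.continuous.continuousAt (x := 0)).eventually_ne hne
  obtain ⟨ε, hε, hball⟩ := Metric.eventually_nhds_iff.1 hev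
  let χ : ContDiffBump (0 : ℝ) := ⟨ε / 4, ε / 2, by positivity, by linarith⟩
  have hχs : ContDiff ℝ ∞ (fun r => (χ r : ℂ)) := Complex.ofRealCLM.contDiff.comp χ.contDiff
  refine ⟨ε / 4, fun r => (χ r : ℂ) * (eqR r)⁻¹, by positivity, ?_, fun r hr => ?_⟩
  · rw [contDiff_iff_contDiffAt]
    intro r
    by_cases h : dist r 0 < ε
    · exact hχs.contDiffAt.mul (contDiff_eqR.contDiffAt.inv (hball h))
    · have hr : r ∉ tsupport (χ : ℝ → ℝ) := by
        rw [χ.tsupport_eq, mem_closedBall]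
        change ¬ dist r 0 ≤ ε / 2
        linarith
      have h0 : (χ : ℝ → ℝ) =ᶠ[𝓝 r] 0 := notMem_tsupport_iff_eventuallyEq.1 hr
      refine (contDiffAt_const (c := (0 : ℂ))).congr_of_eventuallyEq ?_
      filter_upwards [h0] with y hy
      rw [hy, Pi.zero_apply, Complex.ofReal_zero, zero_mul]
  · have hr' : eqR r ≠ 0 := hball (by rw [dist_zero_right, Real.norm_eq_abs]; linarith)
    have hχ1 : χ r = 1 := χ.one_of_mem_closedBall (by
      rw [mem_closedBall, dist_zero_right, Real.norm_eq_abs]; exact hr)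
    change ((𝐞 r : ℂ) - 1) * ((χ r : ℂ) * (eqR r)⁻¹) = (r : ℂ)
    rw [hχ1, Complex.ofReal_one, one_mul, ← ofReal_mul_eqR r]
    field_simp

variable {V : Type*} [NormedAddCommGroup V] [InnerProductSpace ℝ V] [FiniteDimensional ℝ V]
  [MeasurableSpace V] [BorelSpace V]

omit [FiniteDimensional ℝ V] [MeasurableSpace V] [BorelSpace V] in
/-- (Ported verbatim from the HodgeCMPerL package; no docstring in the source.) -/
theorem hasTemperateGrowth_inner_ofReal (b : V) :
    Function.HasTemperateGrowth (fun x : V => ((⟪b, x⟫ : ℝ) : ℂ)) :=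
  (Complex.ofRealCLM.comp (innerSL ℝ b)).hasTemperateGrowth

/-- Multiplication by the coordinate `⟪b, ·⟫` on `𝓢(V, ℂ)`. -/
def coordMul (b : V) : 𝓢(V, ℂ) →L[ℂ] 𝓢(V, ℂ) :=
  SchwartzMap.smulLeftCLM ℂ (fun x : V => ((⟪b, x⟫ : ℝ) : ℂ))

omit [FiniteDimensional ℝ V] [MeasurableSpace V] [BorelSpace V] in
/-- (Ported verbatim from the HodgeCMPerL package; no docstring in the source.) -/
@[simp] theorem coordMul_apply (b : V) (f : 𝓢(V, ℂ)) (x : V) :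
    coordMul b f x = ((⟪b, x⟫ : ℝ) : ℂ) * f x := by
  rw [coordMul, SchwartzMap.smulLeftCLM_apply_apply (hasTemperateGrowth_inner_ofReal b), smul_eq_mul]

/-- **Exact division in `𝓢`**: for a compactly supported Schwartz function `s` and `b : V` there are `c : V` and
`g ∈ 𝓢(V, ℂ)` with `M_c g - g = ⟪b, ·⟫ s`. -/
theorem exists_modCLM_sub_eq_coordMul (b : V) (s : 𝓢(V, ℂ)) (hs : HasCompactSupport (s : V → ℂ)) :
    ∃ (c : V) (g : 𝓢(V, ℂ)), modCLM V c g - g = coordMul b s := by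
  obtain ⟨δ, w, hδ, hw, hdiv⟩ := exists_smooth_fourierChar_sub_one_mul_eq
  obtain ⟨R, hR⟩ := (hs.isBounded : Bornology.IsBounded (tsupport (s : V → ℂ))).subset_closedBall (0 : V)
  set R' : ℝ := max R 1 with hR'
  have hR'pos : 0 < R' := lt_of_lt_of_le one_pos (le_max_right R 1)
  set t : ℝ := δ / (R' * (‖b‖ + 1)) with ht
  have hden : 0 < R' * (‖b‖ + 1) := by positivity
  have htpos : 0 < t := div_pos hδ hden
  have hkey : ∀ x ∈ tsupport (s : V → ℂ), |t * ⟪b, x⟫| ≤ δ := by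
    intro x hx
    have hxR : ‖x‖ ≤ R' := (mem_closedBall_zero_iff.1 (hR hx)).trans (le_max_left R 1)
    rw [abs_mul, abs_of_pos htpos]
    calc t * |⟪b, x⟫| ≤ t * (‖b‖ * ‖x‖) := by gcongr; exact abs_real_inner_le_norm b x
      _ ≤ t * ((‖b‖ + 1) * R') := by gcongr; linarith
      _ = δ := by rw [ht]; field_simp
  let G : V → ℂ := fun x => ((t⁻¹ : ℝ) : ℂ) * w (t * ⟪b, x⟫) * s x
  have hGs : ContDiff ℝ ∞ G := by
    have h1 : ContDiff ℝ ∞ (fun x : V => t * ⟪b, x⟫) := contDiff_const.mul (innerSL ℝ b).contDiff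
    exact (contDiff_const.mul (hw.comp h1)).mul (s.smooth ⊤)
  have hGc : HasCompactSupport G := hs.mul_left
  refine ⟨t • b, hGc.toSchwartzMap hGs, ?_⟩
  ext x
  rw [sub_apply, modCLM_apply, coordMul_apply, real_inner_smul_left]
  change (𝐞 (t * ⟪b, x⟫) : ℂ) * G x - G x = ((⟪b, x⟫ : ℝ) : ℂ) * s x
  by_cases hx : x ∈ tsupport (s : V → ℂ)
  · have h := hdiv (t * ⟪b, x⟫) (hkey x hx)
    have htne : ((t : ℝ) : ℂ) ≠ 0 := by exact_mod_cast htpos.ne'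
    calc (𝐞 (t * ⟪b, x⟫) : ℂ) * G x - G x
        = ((t⁻¹ : ℝ) : ℂ) * (((𝐞 (t * ⟪b, x⟫) : ℂ) - 1) * w (t * ⟪b, x⟫)) * s x := by
          simp only [G]; ring
      _ = ((⟪b, x⟫ : ℝ) : ℂ) * s x := by
          rw [h]; push_cast; field_simp
  · have hsx : s x = 0 := image_eq_zero_of_notMem_tsupport hx
    simp [G, hsx]

end Division

/-! ### A.5 The evaluation functional at `0` -/

section Eval

variable (V : Type*) [NormedAddCommGroup V] [NormedSpace ℝ V]

/-- The Dirac functional `Φ ↦ Φ 0` as a continuous `ℂ`-linear functional on `𝓢(V, ℂ)`. -/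
def evalZero : 𝓢(V, ℂ) →L[ℂ] ℂ :=
  (BoundedContinuousFunction.evalCLM ℂ (0 : V)).comp (SchwartzMap.toBoundedContinuousFunctionCLM ℂ V ℂ)

/-- (Ported verbatim from the HodgeCMPerL package; no docstring in the source.) -/
@[simp] theorem evalZero_apply (f : 𝓢(V, ℂ)) : evalZero V f = f 0 := rfl

end Eval

end SvN

/-! ## Part B. Modulation-invariant functionals are multiples of `δ₀` -/

section Functional

variable {V : Type*} [NormedAddCommGroup V] [InnerProductSpace ℝ V] [FiniteDimensional ℝ V]
  [MeasurableSpace V] [BorelSpace V]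

open SvN

/-- A modulation-invariant continuous linear functional kills `⟪b, ·⟫ f` for every `f ∈ 𝓢(V, ℂ)`. -/
theorem apply_coordMul_eq_zero_of_comp_modCLM (u : 𝓢(V, ℂ) →L[ℂ] ℂ) (hu : ∀ c : V, u.comp (modCLM V c) = u)
    (b : V) (f : 𝓢(V, ℂ)) : u (coordMul b f) = 0 := by
  -- compactly supported `f` first, by exact division
  have hcpt : ∀ s : 𝓢(V, ℂ), HasCompactSupport (s : V → ℂ) → u (coordMul b s) = 0 := by
    intro s hs
    obtain ⟨c, g, hg⟩ := exists_modCLM_sub_eq_coordMul b s hs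
    have h := congrArg (fun T : 𝓢(V, ℂ) →L[ℂ] ℂ => T g) (hu c)
    simp only [ContinuousLinearMap.comp_apply] at h
    rw [← hg, map_sub, h, sub_self]
  -- then all `f` by density of compact cutoffs
  obtain ⟨v, hvc, -, hvt⟩ := exists_hasCompactSupport_tendsto f
  have h1 : Tendsto (fun m => u (coordMul b (v m))) atTop (𝓝 (u (coordMul b f))) :=
    (u.continuous.comp (coordMul b).continuous).continuousAt.tendsto.comp hvt
  have h2 : (fun m => u (coordMul b (v m))) = fun _ => 0 := funext fun m => hcpt (v m) (hvc m)
  rw [h2] at h1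
  exact tendsto_nhds_unique h1 tendsto_const_nhds


-- port_pkg: scope closed for this part
end Functional
end SchwartzWeil
end HodgeCM
end
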